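import Summits.Schanuel.Schanuel.Theorems.SoloInformedFactorialFloor

/-!
# Signed factorial digits: the rate set of Proposition FF at `d = 0` (soloist Remark FF′)

Soloist file (`solo-Schanuel-informed`, residency session s61, 2026-08-22), companion of
`SoloInformedFactorialFloor` (Proposition FF).  It kernel-checks the seat's in-house placement
"atlas r104 (c) / CLAIMS C104" (previously tagged `[D]`): the exact description, in SIGNED
FACTORIAL DIGITS, of the two one-point rate statements through which Proposition FF reads the last
floor below `e ⟂ π`.  Nothing here is deep; the point is the exact typing, so that the `d = 0`
clause of the seat's sharpest statement (§1.3, s32/s60 clause) carries a kernel tag.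

## Notation

For `x : ℝ` and `k : ℕ` let `a_k(x) := round (k!·x) ∈ ℤ` (`facNearest`), `δ_k(x) := k!·x − a_k(x)`
(`facDist`; `|δ_k(x)| = ‖k!·x‖ ≤ 1/2` is the distance from `k!·x` to `ℤ`, `abs_facDist_le`,
`abs_facDist_le_sub`) and the `k`-th SIGNED FACTORIAL DIGIT `D_k(x) := a_{k+1}(x) − (k+1)·a_k(x) ∈ ℤ`
(`facDigit`).  The carry recursion `(k+1)·δ_k = D_k + δ_{k+1}` (`succ_mul_facDist`) is the whole
mechanism.

## Statements

* §2–§3.  `k·|δ_k| → L` forces `δ_k → 0` (`tendsto_facDist_of_rate`); eventually bounded digits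
  `|D_k| ≤ M` force `|δ_k| ≤ (M + 1/2)/(k+1)` (`tendsto_facDist_of_eventually_le`); and when `δ_k → 0`
  the sequences `k·|δ_k|` and `|D_k|` differ by a null sequence (`tendsto_rate_iff_tendsto_abs_facDigit`).
* §4 (**Remark FF′ (a), the rate set**).  For `L > 0`: `k·‖k!·x‖ → L ⟺ L = m ∈ ℤ_{≥ 1}` and
  `D_k(x) ∈ {m, −m}` for all large `k` (`tendsto_rate_iff_facDigit`) — the only positive limits are
  the positive integers, and at each of them the sign pattern of the digits is free.
* §5 (**Remark FF′ (b)**).  `‖k!·x‖ → 0 ⟺ D_k(x) = o(k)`, typed as `D_k(x)/(k+1) → 0`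
  (`tendsto_facDist_iff_facDigit`).
* §6 (**the constant-sign corner**).  `|k!·x − z| < 1/2 ⟹ a_k(x) = z` (`facNearest_eq_of_abs_sub_lt`);
  the digits of `e` are eventually `+1` (`facDigit_exp_one`: `a_k(e) = I_k`, `D_k(e) = 1`); an integer
  relation `a + b·e + c·π = 0` forces, for all large `k`, `a_k(cπ) = −(a·k! + b·I_k)`,
  `δ_k(cπ) = −b·ε_k` and `D_k(cπ) = −b` EXACTLY (`facDigit_of_relation`), whence (non-trivial relation:
  `b ≠ 0 ≠ c` by the irrationality of `e`, `π`) `k·‖k!·cπ‖ → |b|` with eventually CONSTANT digits `−b`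
  (`rate_of_relation`).  Contrapositives (`intForms_one_e_pi_of_facDigit_not_eventually_const`,
  `…_of_no_constant_modulus`): `1, e, π` are `ℚ`-linearly independent as soon as, for every integer
  `c ≠ 0`, the signed factorial digits of `cπ` are not eventually constant — or, weaker, not eventually
  of constant modulus; by §4 the latter says exactly "`k·‖k!·cπ‖` converges to no positive real"
  (`no_rate_iff_no_constant_modulus`), the `d = 0` case of hypothesis (i) of
  `bilinearFloor_of_no_convergent_rate` in `SoloInformedFactorialFloor`, now read as
  a statement about digits — strictly more than the `ℚ`-freeness of `1, e, π` it implies, and, like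
  every digit statement about the named point `π`, addressed by no theorem in print (deaths E19/E20).

## References

* atlas.md of the seat `solo-Schanuel-informed`, §5 REPAIR CENSUS (s60) r104 (c); CLAIMS.jsonl C104.
* [Finch2003] S. R. Finch, *Mathematical Constants*, Cambridge Univ. Press 2003, §1.3 and §2.22.
-/

noncomputable section

open Filter Topology Finset
open scoped Nat

namespace Summit.Schanuel.Schanuel.Theorems

/-! ### §1 Signed factorial digits -/

/-- `facNearest x k = a_k(x)`: the integer nearest to `k!·x` (Mathlib's `round`; ties round up). -/
def facNearest (x : ℝ) (k : ℕ) : ℤ := round ((k ! : ℝ) * x)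

/-- `facDist x k = δ_k(x) := k!·x − a_k(x) ∈ [−1/2, 1/2)`: the SIGNED distance from `k!·x` to the
nearest integer, `|δ_k(x)| = ‖k!·x‖`. -/
def facDist (x : ℝ) (k : ℕ) : ℝ := (k ! : ℝ) * x - facNearest x k

/-- `facDigit x k = D_k(x) := a_{k+1}(x) − (k+1)·a_k(x) ∈ ℤ`: the `k`-th SIGNED factorial digit. -/
def facDigit (x : ℝ) (k : ℕ) : ℤ := facNearest x (k + 1) - (k + 1) * facNearest x k

/-- `|δ_k(x)| ≤ 1/2`. -/
theorem abs_facDist_le (x : ℝ) (k : ℕ) : |facDist x k| ≤ 1 / 2 := abs_sub_round _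

/-- `|δ_k(x)| = ‖k!·x‖` is the distance to `ℤ`: `|δ_k(x)| ≤ |k!·x − z|` for every integer `z`. -/
theorem abs_facDist_le_sub (x : ℝ) (k : ℕ) (z : ℤ) : |facDist x k| ≤ |(k ! : ℝ) * x - z| :=
  round_le _ z

/-- **The carry recursion** `(k+1)·δ_k(x) = D_k(x) + δ_{k+1}(x)`. -/
theorem succ_mul_facDist (x : ℝ) (k : ℕ) :
    ((k : ℝ) + 1) * facDist x k = facDigit x k + facDist x (k + 1) := by
  simp only [facDist, facDigit, Nat.factorial_succ, Nat.cast_mul, Nat.cast_add, Nat.cast_one,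
    Int.cast_sub, Int.cast_mul, Int.cast_add, Int.cast_natCast, Int.cast_one]
  ring

/-- `|(k+1)·|δ_k| − |D_k|| ≤ |δ_{k+1}|`. -/
theorem abs_succ_mul_abs_facDist_sub_abs_facDigit_le (x : ℝ) (k : ℕ) :
    |(((k : ℝ) + 1) * |facDist x k| - |(facDigit x k : ℝ)|)| ≤ |facDist x (k + 1)| := by
  have hk : (0 : ℝ) ≤ (k : ℝ) + 1 := by positivity
  have e1 : ((k : ℝ) + 1) * |facDist x k| = |(facDigit x k : ℝ) + facDist x (k + 1)| := by
    rw [← succ_mul_facDist, abs_mul, abs_of_nonneg hk]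
  rw [e1]
  calc |((|(facDigit x k : ℝ) + facDist x (k + 1)|) - |(facDigit x k : ℝ)|)|
      ≤ |(((facDigit x k : ℝ) + facDist x (k + 1)) - facDigit x k)| := abs_abs_sub_abs_le _ _
    _ = |facDist x (k + 1)| := by rw [add_sub_cancel_left]

/-! ### §2 Two sources of `δ_k → 0` -/

/-- If `k·‖k!·x‖ → L` for some real `L`, then `‖k!·x‖ → 0`. -/
theorem tendsto_facDist_of_rate {x L : ℝ}
    (h : Tendsto (fun k : ℕ => (k : ℝ) * |facDist x k|) atTop (𝓝 L)) :
    Tendsto (fun k : ℕ => facDist x k) atTop (𝓝 0) := by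
  have h1 : Tendsto (fun k : ℕ => ((k : ℝ) * |facDist x k|) * (k : ℝ)⁻¹) atTop (𝓝 (L * 0)) :=
    h.mul (tendsto_inv_atTop_nhds_zero_nat (𝕜 := ℝ))
  rw [mul_zero] at h1
  have h2 : Tendsto (fun k : ℕ => |facDist x k|) atTop (𝓝 0) := by
    refine h1.congr' ?_
    filter_upwards [eventually_ge_atTop 1] with k hk
    have hk' : (k : ℝ) ≠ 0 := by exact_mod_cast Nat.one_le_iff_ne_zero.mp hk
    rw [mul_right_comm, mul_inv_cancel₀ hk', one_mul]
  exact (tendsto_zero_iff_norm_tendsto_zero).mpr (by simpa only [Real.norm_eq_abs] using h2)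

/-- A digit bound `|D_k| ≤ M` gives `|δ_k| ≤ (M + 1/2)/(k+1)`. -/
theorem abs_facDist_le_of_abs_facDigit_le {x M : ℝ} {k : ℕ} (h : |(facDigit x k : ℝ)| ≤ M) :
    |facDist x k| ≤ (M + 1 / 2) / ((k : ℝ) + 1) := by
  have hk : (0 : ℝ) < (k : ℝ) + 1 := by positivity
  rw [le_div_iff₀ hk]
  calc |facDist x k| * ((k : ℝ) + 1) = |((k : ℝ) + 1) * facDist x k| := by
        rw [abs_mul, abs_of_pos hk, mul_comm]
    _ = |(facDigit x k : ℝ) + facDist x (k + 1)| := by rw [succ_mul_facDist]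
    _ ≤ |(facDigit x k : ℝ)| + |facDist x (k + 1)| := abs_add_le _ _
    _ ≤ M + 1 / 2 := add_le_add h (abs_facDist_le x (k + 1))

/-- Eventually bounded digits force `‖k!·x‖ → 0`. -/
theorem tendsto_facDist_of_eventually_le {x M : ℝ}
    (h : ∀ᶠ k in atTop, |(facDigit x k : ℝ)| ≤ M) :
    Tendsto (fun k : ℕ => facDist x k) atTop (𝓝 0) := by
  have h0 : Tendsto (fun k : ℕ => (M + 1 / 2) / ((k : ℝ) + 1)) atTop (𝓝 0) := by
    have := (tendsto_one_div_add_atTop_nhds_zero_nat (𝕜 := ℝ)).const_mul (M + 1 / 2)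
    rw [mul_zero] at this
    refine this.congr fun k => ?_
    ring
  refine squeeze_zero_norm' ?_ h0
  filter_upwards [h] with k hk
  rw [Real.norm_eq_abs]
  exact abs_facDist_le_of_abs_facDigit_le hk

/-! ### §3 `k·‖k!·x‖` and `|D_k(x)|` have the same limits once `‖k!·x‖ → 0` -/

/-- When `δ_k → 0`: `k·|δ_k| − |D_k| → 0`. -/
theorem tendsto_rate_sub_abs_facDigit {x : ℝ}
    (h : Tendsto (fun k : ℕ => facDist x k) atTop (𝓝 0)) :
    Tendsto (fun k : ℕ => (k : ℝ) * |facDist x k| - |(facDigit x k : ℝ)|) atTop (𝓝 0) := by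
  have hab : Tendsto (fun k : ℕ => |facDist x k|) atTop (𝓝 0) := by
    simpa using h.abs
  have hsucc : Tendsto (fun k : ℕ => |facDist x (k + 1)|) atTop (𝓝 0) :=
    hab.comp (tendsto_add_atTop_nat 1)
  have hu : Tendsto (fun k : ℕ => ((k : ℝ) + 1) * |facDist x k| - |(facDigit x k : ℝ)|)
      atTop (𝓝 0) := by
    refine squeeze_zero_norm' (Eventually.of_forall fun k => ?_) hsucc
    rw [Real.norm_eq_abs]
    exact abs_succ_mul_abs_facDist_sub_abs_facDigit_le x k
  have := hu.sub hab
  rw [sub_zero] at this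
  refine this.congr fun k => ?_
  ring

/-- When `‖k!·x‖ → 0`: `k·‖k!·x‖ → L ⟺ |D_k(x)| → L`. -/
theorem tendsto_rate_iff_tendsto_abs_facDigit {x L : ℝ}
    (h : Tendsto (fun k : ℕ => facDist x k) atTop (𝓝 0)) :
    Tendsto (fun k : ℕ => (k : ℝ) * |facDist x k|) atTop (𝓝 L) ↔
      Tendsto (fun k : ℕ => |(facDigit x k : ℝ)|) atTop (𝓝 L) := by
  have h0 := tendsto_rate_sub_abs_facDigit h
  constructor
  · intro hr
    have := hr.sub h0
    rw [sub_zero] at this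
    exact this.congr fun k => by ring
  · intro hD
    have := hD.add h0
    rw [add_zero] at this
    exact this.congr fun k => by ring

/-- An integer sequence converging in `ℝ` is eventually constant, equal to its limit. -/
theorem eventually_eq_of_tendsto_intCast {z : ℕ → ℤ} {L : ℝ}
    (h : Tendsto (fun k : ℕ => (z k : ℝ)) atTop (𝓝 L)) :
    ∃ c : ℤ, L = c ∧ ∀ᶠ k in atTop, z k = c := by
  obtain ⟨N, hN⟩ := (Metric.tendsto_atTop.mp h) (1 / 2) (by norm_num)
  have hconst : ∀ k ≥ N, z k = z N := by
    intro k hk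
    have h1 := hN k hk
    have h2 := hN N le_rfl
    rw [Real.dist_eq, abs_lt] at h1 h2
    have h3 : (z k : ℝ) - z N < 1 ∧ (z N : ℝ) - z k < 1 := by
      constructor <;> linarith [h1.1, h1.2, h2.1, h2.2]
    have h4 : z k - z N < 1 := by exact_mod_cast h3.1
    have h5 : z N - z k < 1 := by exact_mod_cast h3.2
    omega
  refine ⟨z N, ?_, ?_⟩
  · have hc : Tendsto (fun k : ℕ => (z k : ℝ)) atTop (𝓝 (z N : ℝ)) := by
      refine (tendsto_const_nhds (x := (z N : ℝ))).congr' ?_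
      filter_upwards [eventually_ge_atTop N] with k hk
      rw [hconst k hk]
    exact tendsto_nhds_unique h hc
  · filter_upwards [eventually_ge_atTop N] with k hk using hconst k hk

/-! ### §4 Remark FF′ (a): the rate set -/

/-- **Remark FF′ (a), the rate set.**  For `L > 0`: `k·‖k!·x‖ → L` iff `L` is a positive integer
`m` and the signed factorial digits `D_k(x)` lie in `{m, −m}` for all large `k`. -/
theorem tendsto_rate_iff_facDigit {x L : ℝ} (hL : 0 < L) :
    Tendsto (fun k : ℕ => (k : ℝ) * |facDist x k|) atTop (𝓝 L) ↔
      ∃ m : ℕ, 1 ≤ m ∧ L = m ∧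
        ∀ᶠ k in atTop, facDigit x k = m ∨ facDigit x k = -(m : ℤ) := by
  constructor
  · intro hr
    have hδ := tendsto_facDist_of_rate hr
    have hD := (tendsto_rate_iff_tendsto_abs_facDigit hδ).mp hr
    have hD' : Tendsto (fun k : ℕ => ((|facDigit x k| : ℤ) : ℝ)) atTop (𝓝 L) := by
      simpa only [Int.cast_abs] using hD
    obtain ⟨c, hLc, hc⟩ := eventually_eq_of_tendsto_intCast hD'
    have hc0 : 0 < c := by
      have : (0 : ℝ) < c := hLc ▸ hL
      exact_mod_cast this
    have htn : ((c.toNat : ℕ) : ℤ) = c := Int.toNat_of_nonneg hc0.le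
    refine ⟨c.toNat, by omega, ?_, ?_⟩
    · rw [hLc]
      exact_mod_cast htn.symm
    · filter_upwards [hc] with k hk
      rw [htn]
      exact (abs_eq hc0.le).mp hk
  · rintro ⟨m, hm, hLm, hev⟩
    have habsR : ∀ᶠ k in atTop, |(facDigit x k : ℝ)| = (m : ℝ) := by
      filter_upwards [hev] with k hk
      have hk' : |facDigit x k| = (m : ℤ) := (abs_eq (by positivity)).mpr hk
      rw [← Int.cast_abs, hk']
      norm_cast
    have hδ : Tendsto (fun k : ℕ => facDist x k) atTop (𝓝 0) :=
      tendsto_facDist_of_eventually_le (M := (m : ℝ))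
        (by filter_upwards [habsR] with k hk using hk.le)
    rw [tendsto_rate_iff_tendsto_abs_facDigit hδ, hLm]
    exact (tendsto_const_nhds (x := (m : ℝ))).congr'
      (by filter_upwards [habsR] with k hk using hk.symm)

/-! ### §5 Remark FF′ (b): `𝓔 = {‖k!·x‖ → 0}` in digits -/

/-- **Remark FF′ (b).**  `‖k!·x‖ → 0 ⟺ D_k(x) = o(k)`, typed as `D_k(x)/(k+1) → 0`. -/
theorem tendsto_facDist_iff_facDigit {x : ℝ} :
    Tendsto (fun k : ℕ => facDist x k) atTop (𝓝 0) ↔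
      Tendsto (fun k : ℕ => (facDigit x k : ℝ) / ((k : ℝ) + 1)) atTop (𝓝 0) := by
  -- `δ_{k+1}/(k+1) → 0` unconditionally
  have ht : Tendsto (fun k : ℕ => facDist x (k + 1) / ((k : ℝ) + 1)) atTop (𝓝 0) := by
    have h0 : Tendsto (fun k : ℕ => (1 / 2 : ℝ) * (1 / ((k : ℝ) + 1))) atTop (𝓝 0) := by
      simpa using (tendsto_one_div_add_atTop_nhds_zero_nat (𝕜 := ℝ)).const_mul (1 / 2 : ℝ)
    refine squeeze_zero_norm' (Eventually.of_forall fun k => ?_) h0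
    have hk : (0 : ℝ) < (k : ℝ) + 1 := by positivity
    rw [Real.norm_eq_abs, abs_div, abs_of_pos hk, div_eq_mul_one_div]
    exact mul_le_mul_of_nonneg_right (abs_facDist_le x (k + 1)) (by positivity)
  -- the identity `D_k/(k+1) = δ_k − δ_{k+1}/(k+1)`
  have hid : ∀ k : ℕ, (facDigit x k : ℝ) / ((k : ℝ) + 1)
      = facDist x k - facDist x (k + 1) / ((k : ℝ) + 1) := by
    intro k
    have hk : ((k : ℝ) + 1) ≠ 0 := by positivity
    have e' : (facDigit x k : ℝ) = ((k : ℝ) + 1) * facDist x k - facDist x (k + 1) := by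
      linarith [succ_mul_facDist x k]
    rw [e', sub_div, mul_div_cancel_left₀ _ hk]
  constructor
  · intro hδ
    have := hδ.sub ht
    rw [sub_zero] at this
    exact this.congr fun k => (hid k).symm
  · intro hD
    have := hD.add ht
    rw [add_zero] at this
    refine this.congr fun k => ?_
    rw [hid k]
    ring

/-! ### §6 The constant-sign corner: `e`, and `cπ` under a relation `a + be + cπ = 0` -/

/-- Nearest integer from an explicit approximation: `|k!·x − z| < 1/2 ⟹ a_k(x) = z`. -/
theorem facNearest_eq_of_abs_sub_lt {x : ℝ} {k : ℕ} {z : ℤ}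
    (h : |(k ! : ℝ) * x - z| < 1 / 2) : facNearest x k = z := by
  unfold facNearest
  rw [round_eq_iff, Set.mem_Ico]
  rw [abs_lt] at h
  constructor <;> linarith [h.1, h.2]

/-- The digits of `e`: for all large `k`, `a_k(e) = I_k` and `D_k(e) = I_{k+1} − (k+1)·I_k = 1`
(so `k·‖k!·e‖ = k·ε_k → 1` with all digits `+1`). -/
theorem facDigit_exp_one :
    ∀ᶠ k in atTop, facNearest (Real.exp 1) k = facSum k ∧ facDigit (Real.exp 1) k = 1 := by
  have hsmall : ∀ᶠ k in atTop, expTail k < 1 / 2 :=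
    (tendsto_order.mp tendsto_expTail).2 _ (by norm_num)
  have hnear : ∀ᶠ k in atTop, facNearest (Real.exp 1) k = facSum k := by
    filter_upwards [hsmall] with k hk
    apply facNearest_eq_of_abs_sub_lt
    have : (k ! : ℝ) * Real.exp 1 - ((facSum k : ℤ) : ℝ) = expTail k := by
      unfold expTail; push_cast; ring
    rw [this, abs_of_pos (expTail_pos k)]
    exact hk
  filter_upwards [hnear, (tendsto_add_atTop_nat 1).eventually hnear] with k hk hk1
  have hk1' : facNearest (Real.exp 1) (k + 1) = facSum (k + 1) := hk1
  refine ⟨hk, ?_⟩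
  unfold facDigit
  rw [hk, hk1', facSum_succ]
  push_cast
  ring

/-- Under an integer relation `a + b·e + c·π = 0`: for all large `k` (as soon as `|b|·ε_k < 1/2`),
`a_k(cπ) = −(a·k! + b·I_k)`, `δ_k(cπ) = −b·ε_k` and `D_k(cπ) = −b` exactly. -/
theorem facDigit_of_relation {a b c : ℤ}
    (h : (a : ℝ) + b * Real.exp 1 + c * Real.pi = 0) :
    ∀ᶠ k in atTop, facNearest (c * Real.pi) k = -(a * k ! + b * facSum k) ∧
      facDist (c * Real.pi) k = -(b : ℝ) * expTail k ∧ facDigit (c * Real.pi) k = -b := by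
  -- `|b|·ε_k < 1/2` eventually
  have hsmall : ∀ᶠ k in atTop, |(b : ℝ)| * expTail k < 1 / 2 := by
    have := tendsto_expTail.const_mul (|(b : ℝ)|)
    rw [mul_zero] at this
    exact (tendsto_order.mp this).2 _ (by norm_num)
  -- the identity `k!·(cπ) − (−(a·k! + b·I_k)) = −b·ε_k` at every `k`
  have hid : ∀ k : ℕ, (k ! : ℝ) * (c * Real.pi) - ((-(a * k ! + b * facSum k) : ℤ) : ℝ)
      = -(b : ℝ) * expTail k := by
    intro k
    unfold expTail
    push_cast
    linear_combination (k ! : ℝ) * h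
  have hnear : ∀ᶠ k in atTop, facNearest (c * Real.pi) k = -(a * k ! + b * facSum k) := by
    filter_upwards [hsmall] with k hk
    apply facNearest_eq_of_abs_sub_lt
    rw [hid k, abs_mul, abs_neg, abs_of_pos (expTail_pos k)]
    exact hk
  filter_upwards [hnear, (tendsto_add_atTop_nat 1).eventually hnear] with k hk hk1
  have hk1' : facNearest (c * Real.pi) (k + 1) = -(a * (k + 1)! + b * facSum (k + 1)) := hk1
  refine ⟨hk, ?_, ?_⟩
  · unfold facDist; rw [hk]; exact hid k
  · unfold facDigit
    rw [hk, hk1', facSum_succ, Nat.factorial_succ]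
    push_cast
    ring

/-- **The constant-sign corner.**  Under a non-trivial integer relation `a + b·e + c·π = 0`
(necessarily `b ≠ 0 ≠ c`, by the irrationality of `e` and `π`), the signed factorial digits of
`cπ` are eventually the non-zero CONSTANT `−b`, and `k·‖k!·cπ‖ → |b|`. -/
theorem rate_of_relation {a b c : ℤ}
    (h : (a : ℝ) + b * Real.exp 1 + c * Real.pi = 0) (hne : ¬ (a = 0 ∧ b = 0 ∧ c = 0)) :
    b ≠ 0 ∧ c ≠ 0 ∧ (∀ᶠ k in atTop, facDigit (c * Real.pi) k = -b) ∧
      Tendsto (fun k : ℕ => (k : ℝ) * |facDist (c * Real.pi) k|) atTop (𝓝 |(b : ℝ)|) := by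
  have h4 : (a : ℝ) + b * Real.exp 1 + c * Real.pi + ((0 : ℤ) : ℝ) * (Real.exp 1 * Real.pi) = 0 := by
    push_cast
    linear_combination h
  obtain ⟨hcd, hb⟩ := ne_of_relation h4 (fun ⟨ha, hb, hc, _⟩ => hne ⟨ha, hb, hc⟩)
  have hc : c ≠ 0 := hcd.resolve_right (fun h0 => h0 rfl)
  have hb' : b ≠ 0 := by intro hb0; apply hb; simp [hb0]
  have hdig : ∀ᶠ k in atTop, facDigit (c * Real.pi) k = -b :=
    (facDigit_of_relation h).mono fun k hk => hk.2.2
  refine ⟨hb', hc, hdig, ?_⟩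
  have habs : (0 : ℝ) < |(b : ℝ)| := abs_pos.mpr (by exact_mod_cast hb')
  rw [tendsto_rate_iff_facDigit habs]
  refine ⟨b.natAbs, by omega, ?_, ?_⟩
  · rw [Nat.cast_natAbs, Int.cast_abs]
  · filter_upwards [hdig] with k hk
    rw [hk]
    omega

/-- **`1, e, π` are `ℚ`-linearly independent if, for every integer `c ≠ 0`, the signed factorial
digits of `cπ` are not eventually constant** — a one-point digit statement about `π`. -/
theorem intForms_one_e_pi_of_facDigit_not_eventually_const
    (H : ∀ c : ℤ, c ≠ 0 → ∀ b : ℤ, ¬ ∀ᶠ k in atTop, facDigit (c * Real.pi) k = b) :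
    ∀ a b c : ℤ, (a : ℝ) + b * Real.exp 1 + c * Real.pi = 0 → a = 0 ∧ b = 0 ∧ c = 0 := by
  intro a b c h
  by_contra hne
  obtain ⟨-, hc, hdig, -⟩ := rate_of_relation h hne
  exact H c hc (-b) hdig

/-- The same with the weaker hypothesis "not eventually of constant MODULUS" — by
`tendsto_rate_iff_facDigit` exactly "`k·‖k!·cπ‖` converges to no positive real", the `d = 0` case
of hypothesis (i) of `bilinearFloor_of_no_convergent_rate`. -/
theorem intForms_one_e_pi_of_no_constant_modulus
    (H : ∀ c : ℤ, c ≠ 0 → ∀ m : ℕ, ¬ ∀ᶠ k in atTop, (facDigit (c * Real.pi) k).natAbs = m) :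
    ∀ a b c : ℤ, (a : ℝ) + b * Real.exp 1 + c * Real.pi = 0 → a = 0 ∧ b = 0 ∧ c = 0 := by
  intro a b c h
  by_contra hne
  obtain ⟨-, hc, hdig, -⟩ := rate_of_relation h hne
  refine H c hc b.natAbs ?_
  filter_upwards [hdig] with k hk
  rw [hk, Int.natAbs_neg]

/-- Conversely to the digit hypotheses: "`k·‖k!·cπ‖` converges to no positive real for any
`c ≠ 0`" is EQUIVALENT to "for no `c ≠ 0` are the digits of `cπ` eventually of constant non-zero
modulus" (bookkeeping instance of §4). -/
theorem no_rate_iff_no_constant_modulus (c : ℤ) :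
    (∀ L : ℝ, 0 < L → ¬ Tendsto (fun k : ℕ => (k : ℝ) * |facDist (c * Real.pi) k|) atTop (𝓝 L)) ↔
      ∀ m : ℕ, 1 ≤ m → ¬ ∀ᶠ k in atTop, (facDigit (c * Real.pi) k).natAbs = m := by
  constructor
  · intro H m hm hev
    refine H m (by exact_mod_cast hm) ((tendsto_rate_iff_facDigit (by exact_mod_cast hm)).mpr
      ⟨m, hm, rfl, ?_⟩)
    filter_upwards [hev] with k hk
    omega
  · intro H L hL hlim
    obtain ⟨m, hm, -, hev⟩ := (tendsto_rate_iff_facDigit hL).mp hlim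
    refine H m hm ?_
    filter_upwards [hev] with k hk
    omega

end Summit.Schanuel.Schanuel.Theorems

end
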